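import Mathlib.Analysis.InnerProductSpace.Calculus
import Literature.Analysis.FluidPDE.LipschitzCutoffIBP
import HarnessLib

/-!
# The integration by parts behind the `Y₆` estimate: `∫ ⟪f, DH f⟫ ηχ` against a Lipschitz cutoff

Analysis/FluidPDE support file for the discharge of the named fact
`Literature.Analysis.FluidPDE.tao2011_nonlinearEstimate` (Tao 2011, §10, proof of Thm. 10.1,
estimate of the nonlinear term `Y₆ = ∫ O(ω ω ∇u) η`, arXiv:1108.1165 pp. 31–33; Tao integrates the
enstrophy equation "against the Lipschitz, compactly supported `η` and integrat[es] by parts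
[…] (interpreting derivatives of `η` in a distributional sense)", p. 31). In our variant of the
`Y₆` argument the velocity gradient on a Whitney shell is `Du = -DH + DV` with `H` the truncated
Newtonian potential of `curl ω` (`FluidPDE/TaoY6LocalBiotSavart`); the contribution of `H` to
`∫ ⟪ω, Du ω⟫ η χ` is integrated by parts in physical space, so that only `H` itself (an order
`-1` potential of `∇ω`, controlled by Cauchy–Schwarz) and one derivative of `ω` appear. This file
proves that step for a general `C¹` vector field `f`, a `C¹` field `H`, a `C¹` compactly supported
cutoff `0 ≤ χ ≤ 1` with `‖Dχ‖ ≤ L`, and a `k`-Lipschitz compactly supported weight `η ≥ 0` with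
`η ≤ 4θ` on the support of `χ` and `θ L ≤ c_L k`:

  `|∫ ⟪f, DH f⟫ η χ| ≤ 6 ∫ ‖Df‖ ‖f‖ ‖H‖ η χ + (3 + 12 c_L) k ∫_{supp χ} ‖f‖² ‖H‖`

(`abs_integral_inner_fderiv_apply_le`). Pointwise, in an orthonormal frame,
`⟪f, DH f⟫ = Σⱼ fⱼ (∂ⱼ⟪f, H⟫ − ⟪∂ⱼf, H⟫)`, and `∫ fⱼ χ ∂ⱼ⟪f,H⟫ η = −∫ ⟪f,H⟫ fⱼ χ ∂ⱼη − ∫ ⟪f,H⟫ ∂ⱼ(fⱼχ) η`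
by the tree's integration by parts against Lipschitz weights
(`Literature.Analysis.FluidPDE.integral_fderiv_apply_mul_eq_neg_integral_mul_lineDeriv`).

## References

* T. Tao, arXiv:1108.1165 (`Tao2011`), §10, proof of Thm. 10.1, pp. 31–33.
-/

noncomputable section

open MeasureTheory Set Filter Metric Function
open scoped RealInnerProductSpace NNReal

namespace Literature.Analysis.FluidPDE.TaoY6

variable {E : Type*} [NormedAddCommGroup E] [InnerProductSpace ℝ E] [FiniteDimensional ℝ E]
  [MeasurableSpace E] [BorelSpace E]

section OneDirection

variable {f H : E → E} {χ η : E → ℝ} {k : ℝ}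

omit [FiniteDimensional ℝ E] [MeasurableSpace E] [BorelSpace E] in
/-- Pointwise: `⟪f, DH e⟫ = ∂ₑ⟪f, H⟫ − ⟪∂ₑ f, H⟫`. [folklore] -/
theorem inner_fderiv_apply_eq (hf : Differentiable ℝ f) (hH : Differentiable ℝ H) (y e : E) :
    ⟪f y, fderiv ℝ H y e⟫ = fderiv ℝ (fun t => ⟪f t, H t⟫) y e - ⟪fderiv ℝ f y e, H y⟫ := by
  rw [fderiv_inner_apply ℝ (hf y) (hH y) e]; ring

/-- **One direction of the integration by parts**: for a vector `e` with `‖e‖ ≤ 1`,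
`|∫ ⟪e, f⟫ ⟪f, DH e⟫ η χ| ≤ k ∫ ‖f‖²‖H‖ χ + ∫ ‖f‖ ‖H‖ (‖Df‖ χ + ‖f‖ ‖Dχ‖) η + ∫ ‖f‖ ‖Df‖ ‖H‖ η χ`. [folklore] -/
theorem abs_integral_coord_mul_inner_fderiv_apply_le (hf : ContDiff ℝ 1 f) (hH : ContDiff ℝ 1 H)
    (hχ : ContDiff ℝ 1 χ) (hχc : HasCompactSupport χ) (hχ0 : ∀ y, 0 ≤ χ y)
    (hk : 0 ≤ k) (hη : LipschitzWith (Real.toNNReal k) η)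
    (hηc : HasCompactSupport η) (hη0 : ∀ y, 0 ≤ η y) {e : E} (he : ‖e‖ ≤ 1) :
    |∫ y, ⟪e, f y⟫ * ⟪f y, fderiv ℝ H y e⟫ * (η y * χ y)| ≤
      k * (∫ y, ‖f y‖ ^ 2 * ‖H y‖ * χ y) +
        (∫ y, ‖f y‖ * ‖H y‖ * (‖fderiv ℝ f y‖ * χ y + ‖f y‖ * ‖fderiv ℝ χ y‖) * η y) +
        ∫ y, ‖f y‖ * ‖fderiv ℝ f y‖ * ‖H y‖ * (η y * χ y) := by
  -- regularity
  have hfd : Differentiable ℝ f := hf.differentiable one_ne_zero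
  have hHd : Differentiable ℝ H := hH.differentiable one_ne_zero
  have hχd : Differentiable ℝ χ := hχ.differentiable one_ne_zero
  have hfc : Continuous f := hf.continuous
  have hHc : Continuous H := hH.continuous
  have hχcont : Continuous χ := hχ.continuous
  have hηcont : Continuous η := hη.continuous
  have hDf : Continuous (fderiv ℝ f) := hf.continuous_fderiv one_ne_zero
  have hDχ : Continuous (fderiv ℝ χ) := hχ.continuous_fderiv one_ne_zero
  -- the scalar functions `P = ⟪f, H⟫`, `c = ⟪e, f⟫`, `G = P (c χ)`
  set P : E → ℝ := fun t => ⟪f t, H t⟫ with hP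
  set c : E → ℝ := fun t => ⟪e, f t⟫ with hc
  have hP1 : ContDiff ℝ 1 P := hf.inner ℝ hH
  have hc1 : ContDiff ℝ 1 c := contDiff_const.inner ℝ hf
  have hcχ1 : ContDiff ℝ 1 fun t => c t * χ t := hc1.mul hχ
  have hG1 : ContDiff ℝ 1 fun t => P t * (c t * χ t) := hP1.mul hcχ1
  have hPc : Continuous P := hP1.continuous
  have hcc : Continuous c := hc1.continuous
  -- pointwise bounds
  have hcle : ∀ y, |c y| ≤ ‖f y‖ := fun y =>
    (abs_real_inner_le_norm e (f y)).trans (by nlinarith [norm_nonneg (f y)])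
  have hPle : ∀ y, |P y| ≤ ‖f y‖ * ‖H y‖ := fun y => abs_real_inner_le_norm _ _
  have hDc : ∀ y, fderiv ℝ c y e = ⟪e, fderiv ℝ f y e⟫ := fun y => by
    rw [hc, fderiv_inner_apply ℝ (differentiableAt_const e) (hfd y) e, fderiv_const_apply]
    simp
  have hDcle : ∀ y, |fderiv ℝ c y e| ≤ ‖fderiv ℝ f y‖ := fun y => by
    rw [hDc]
    calc |⟪e, fderiv ℝ f y e⟫| ≤ ‖e‖ * ‖fderiv ℝ f y e‖ := abs_real_inner_le_norm _ _
      _ ≤ 1 * (‖fderiv ℝ f y‖ * ‖e‖) := mul_le_mul he (ContinuousLinearMap.le_opNorm _ _)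
          (norm_nonneg _) zero_le_one
      _ ≤ ‖fderiv ℝ f y‖ := by nlinarith [norm_nonneg (fderiv ℝ f y), norm_nonneg e]
  have hDcχ : ∀ y, fderiv ℝ (fun t => c t * χ t) y e = fderiv ℝ c y e * χ y + c y * fderiv ℝ χ y e :=
    fun y => by
      rw [fderiv_fun_mul (hc1.differentiable one_ne_zero y) (hχd y)]
      simp only [_root_.add_apply, _root_.FunLike.coe_smul, Pi.smul_apply, smul_eq_mul]
      ring
  have hDcχle : ∀ y, |fderiv ℝ (fun t => c t * χ t) y e| ≤
      ‖fderiv ℝ f y‖ * χ y + ‖f y‖ * ‖fderiv ℝ χ y‖ := fun y => by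
    rw [hDcχ]
    have h1 : |fderiv ℝ c y e * χ y| ≤ ‖fderiv ℝ f y‖ * χ y := by
      rw [abs_mul, abs_of_nonneg (hχ0 y)]
      exact mul_le_mul_of_nonneg_right (hDcle y) (hχ0 y)
    have h2 : |c y * fderiv ℝ χ y e| ≤ ‖f y‖ * ‖fderiv ℝ χ y‖ := by
      rw [abs_mul]
      refine mul_le_mul (hcle y) ?_ (abs_nonneg _) (norm_nonneg _)
      calc |fderiv ℝ χ y e| = ‖fderiv ℝ χ y e‖ := (Real.norm_eq_abs _).symm
        _ ≤ ‖fderiv ℝ χ y‖ * ‖e‖ := ContinuousLinearMap.le_opNorm _ _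
        _ ≤ ‖fderiv ℝ χ y‖ * 1 := mul_le_mul_of_nonneg_left he (norm_nonneg _)
        _ = ‖fderiv ℝ χ y‖ := mul_one _
    exact (abs_add_le _ _).trans (add_le_add h1 h2)
  have hlineD : ∀ y, |lineDeriv ℝ η y e| ≤ k := fun y => by
    have h := norm_lineDeriv_le_of_lipschitz ℝ (x₀ := y) (v := e) hη
    rw [Real.coe_toNNReal _ hk, Real.norm_eq_abs] at h
    exact h.trans (by nlinarith)
  -- the pointwise identity of the integrand
  have hpt : ∀ y, c y * ⟪f y, fderiv ℝ H y e⟫ * (η y * χ y) =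
      fderiv ℝ (fun t => P t * (c t * χ t)) y e * η y -
        P y * fderiv ℝ (fun t => c t * χ t) y e * η y -
        c y * ⟪fderiv ℝ f y e, H y⟫ * (η y * χ y) := fun y => by
    rw [inner_fderiv_apply_eq hfd hHd y e,
      fderiv_fun_mul (hP1.differentiable one_ne_zero y) (hcχ1.differentiable one_ne_zero y)]
    simp only [_root_.add_apply, _root_.FunLike.coe_smul, Pi.smul_apply, smul_eq_mul]
    ring
  -- integrability of the three pieces (continuous with compact support)
  have hsupp1 : HasCompactSupport fun y => fderiv ℝ (fun t => P t * (c t * χ t)) y e * η y :=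
    hηc.mul_left
  have hint1 : Integrable fun y => fderiv ℝ (fun t => P t * (c t * χ t)) y e * η y :=
    (((hG1.continuous_fderiv one_ne_zero).clm_apply continuous_const).mul hηcont)
      |>.integrable_of_hasCompactSupport hsupp1
  have hcont2 : Continuous fun y => P y * fderiv ℝ (fun t => c t * χ t) y e * η y :=
    (hPc.mul ((hcχ1.continuous_fderiv one_ne_zero).clm_apply continuous_const)).mul hηcont
  have hint2 : Integrable fun y => P y * fderiv ℝ (fun t => c t * χ t) y e * η y :=
    hcont2.integrable_of_hasCompactSupport hηc.mul_left
  have hcont3 : Continuous fun y => c y * ⟪fderiv ℝ f y e, H y⟫ * (η y * χ y) :=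
    (hcc.mul ((hDf.clm_apply continuous_const).inner hHc)).mul (hηcont.mul hχcont)
  have hint3 : Integrable fun y => c y * ⟪fderiv ℝ f y e, H y⟫ * (η y * χ y) :=
    hcont3.integrable_of_hasCompactSupport (hχc.mul_left.mul_left)
  -- integrate the identity and integrate by parts in the first term
  have hIBP := integral_fderiv_apply_mul_eq_neg_integral_mul_lineDeriv (volume : Measure E) hG1 hη hηc e
  have hsplit : ∫ y, c y * ⟪f y, fderiv ℝ H y e⟫ * (η y * χ y) =
      -(∫ y, P y * (c y * χ y) * lineDeriv ℝ η y e) -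
        (∫ y, P y * fderiv ℝ (fun t => c t * χ t) y e * η y) -
        ∫ y, c y * ⟪fderiv ℝ f y e, H y⟫ * (η y * χ y) := by
    simp_rw [hpt]
    have hint12 : Integrable fun y => fderiv ℝ (fun t => P t * (c t * χ t)) y e * η y -
        P y * fderiv ℝ (fun t => c t * χ t) y e * η y := hint1.sub hint2
    rw [integral_sub hint12 hint3, integral_sub hint1 hint2, hIBP]
  -- bound the three integrals
  have hB1 : |∫ y, P y * (c y * χ y) * lineDeriv ℝ η y e| ≤ k * ∫ y, ‖f y‖ ^ 2 * ‖H y‖ * χ y := by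
    rw [← integral_const_mul, ← Real.norm_eq_abs]
    refine norm_integral_le_of_norm_le ((((hfc.norm.pow 2).mul hHc.norm).mul hχcont).const_mul k
      |>.integrable_of_hasCompactSupport (hχc.mul_left.mul_left)) (Eventually.of_forall fun y => ?_)
    rw [Real.norm_eq_abs, abs_mul, abs_mul, abs_mul, abs_of_nonneg (hχ0 y)]
    have hχy := hχ0 y
    have h1 : |P y| * (|c y| * χ y) ≤ ‖f y‖ * ‖H y‖ * (‖f y‖ * χ y) :=
      mul_le_mul (hPle y) (mul_le_mul_of_nonneg_right (hcle y) hχy)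
        (mul_nonneg (abs_nonneg _) hχy) (mul_nonneg (norm_nonneg _) (norm_nonneg _))
    calc |P y| * (|c y| * χ y) * |lineDeriv ℝ η y e| ≤ ‖f y‖ * ‖H y‖ * (‖f y‖ * χ y) * k :=
          mul_le_mul h1 (hlineD y) (abs_nonneg _)
            (mul_nonneg (mul_nonneg (norm_nonneg _) (norm_nonneg _)) (mul_nonneg (norm_nonneg _) hχy))
      _ = k * (‖f y‖ ^ 2 * ‖H y‖ * χ y) := by ring
  have hB2 : |∫ y, P y * fderiv ℝ (fun t => c t * χ t) y e * η y| ≤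
      ∫ y, ‖f y‖ * ‖H y‖ * (‖fderiv ℝ f y‖ * χ y + ‖f y‖ * ‖fderiv ℝ χ y‖) * η y := by
    rw [← Real.norm_eq_abs]
    refine norm_integral_le_of_norm_le ?_ (Eventually.of_forall fun y => ?_)
    · exact (((hfc.norm.mul hHc.norm).mul ((hDf.norm.mul hχcont).add (hfc.norm.mul hDχ.norm))).mul
        hηcont).integrable_of_hasCompactSupport hηc.mul_left
    · rw [Real.norm_eq_abs, abs_mul, abs_mul, abs_of_nonneg (hη0 y)]
      gcongr
      · exact hη0 y
      · exact hPle y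
      · exact hDcχle y
  have hB3 : |∫ y, c y * ⟪fderiv ℝ f y e, H y⟫ * (η y * χ y)| ≤
      ∫ y, ‖f y‖ * ‖fderiv ℝ f y‖ * ‖H y‖ * (η y * χ y) := by
    rw [← Real.norm_eq_abs]
    refine norm_integral_le_of_norm_le ?_ (Eventually.of_forall fun y => ?_)
    · exact (((hfc.norm.mul hDf.norm).mul hHc.norm).mul (hηcont.mul hχcont))
        |>.integrable_of_hasCompactSupport (hχc.mul_left.mul_left)
    · rw [Real.norm_eq_abs, abs_mul, abs_mul, abs_of_nonneg (mul_nonneg (hη0 y) (hχ0 y))]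
      have h1 : |⟪fderiv ℝ f y e, H y⟫| ≤ ‖fderiv ℝ f y‖ * ‖H y‖ :=
        (abs_real_inner_le_norm _ _).trans (mul_le_mul_of_nonneg_right
          ((ContinuousLinearMap.le_opNorm _ _).trans (by nlinarith [norm_nonneg (fderiv ℝ f y)]))
          (norm_nonneg _))
      calc |c y| * |⟪fderiv ℝ f y e, H y⟫| * (η y * χ y)
          ≤ ‖f y‖ * (‖fderiv ℝ f y‖ * ‖H y‖) * (η y * χ y) := by
            gcongr
            · exact mul_nonneg (hη0 y) (hχ0 y)
            · exact hcle y
        _ = ‖f y‖ * ‖fderiv ℝ f y‖ * ‖H y‖ * (η y * χ y) := by ring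
  rw [hsplit]
  calc |-(∫ y, P y * (c y * χ y) * lineDeriv ℝ η y e) -
          (∫ y, P y * fderiv ℝ (fun t => c t * χ t) y e * η y) -
          ∫ y, c y * ⟪fderiv ℝ f y e, H y⟫ * (η y * χ y)|
      ≤ |∫ y, P y * (c y * χ y) * lineDeriv ℝ η y e| +
          |∫ y, P y * fderiv ℝ (fun t => c t * χ t) y e * η y| +
          |∫ y, c y * ⟪fderiv ℝ f y e, H y⟫ * (η y * χ y)| := by
        refine (abs_sub _ _).trans (add_le_add ((abs_sub _ _).trans (add_le_add ?_ le_rfl)) le_rfl)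
        rw [abs_neg]
    _ ≤ _ := add_le_add (add_le_add hB1 hB2) hB3

end OneDirection

section Sum

variable {ι : Type*} [Fintype ι] {f H : E → E} {χ η : E → ℝ} {k : ℝ}

omit [FiniteDimensional ℝ E] [MeasurableSpace E] [BorelSpace E] in
/-- Expansion in an orthonormal frame: `⟪x, L x⟫ = Σⱼ ⟪bⱼ, x⟫ ⟪x, L bⱼ⟫`. [folklore] -/
theorem inner_apply_self_eq_sum (b : OrthonormalBasis ι ℝ E) (L : E →L[ℝ] E) (x : E) :
    ⟪x, L x⟫ = ∑ j, ⟪b j, x⟫ * ⟪x, L (b j)⟫ := by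
  have h : L x = ∑ j, ⟪b j, x⟫ • L (b j) := by
    conv_lhs => rw [← b.sum_repr' x]
    rw [map_sum]
    simp_rw [map_smul]
  rw [h, inner_sum]
  simp_rw [real_inner_smul_right]

/-- **The integration by parts, summed over a frame**:
`|∫ ⟪f, DH f⟫ η χ| ≤ (card ι) (k ∫ ‖f‖²‖H‖ χ + ∫ ‖f‖ ‖H‖ (‖Df‖ χ + ‖f‖ ‖Dχ‖) η + ∫ ‖f‖ ‖Df‖ ‖H‖ η χ)`.
[folklore] -/
theorem abs_integral_inner_fderiv_apply_self_le (b : OrthonormalBasis ι ℝ E) (hf : ContDiff ℝ 1 f)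
    (hH : ContDiff ℝ 1 H) (hχ : ContDiff ℝ 1 χ) (hχc : HasCompactSupport χ) (hχ0 : ∀ y, 0 ≤ χ y)
    (hk : 0 ≤ k) (hη : LipschitzWith (Real.toNNReal k) η) (hηc : HasCompactSupport η)
    (hη0 : ∀ y, 0 ≤ η y) :
    |∫ y, ⟪f y, fderiv ℝ H y (f y)⟫ * (η y * χ y)| ≤
      Fintype.card ι * (k * (∫ y, ‖f y‖ ^ 2 * ‖H y‖ * χ y) +
        (∫ y, ‖f y‖ * ‖H y‖ * (‖fderiv ℝ f y‖ * χ y + ‖f y‖ * ‖fderiv ℝ χ y‖) * η y) +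
        ∫ y, ‖f y‖ * ‖fderiv ℝ f y‖ * ‖H y‖ * (η y * χ y)) := by
  have hfc : Continuous f := hf.continuous
  have hHD : Continuous (fderiv ℝ H) := hH.continuous_fderiv one_ne_zero
  have hpt : ∀ y, ⟪f y, fderiv ℝ H y (f y)⟫ * (η y * χ y) =
      ∑ j, ⟪b j, f y⟫ * ⟪f y, fderiv ℝ H y (b j)⟫ * (η y * χ y) := fun y => by
    rw [inner_apply_self_eq_sum b, Finset.sum_mul]
  have hint : ∀ j, Integrable fun y => ⟪b j, f y⟫ * ⟪f y, fderiv ℝ H y (b j)⟫ * (η y * χ y) := fun j =>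
    (((continuous_const.inner hfc).mul (hfc.inner (hHD.clm_apply continuous_const))).mul
      (hη.continuous.mul hχ.continuous)).integrable_of_hasCompactSupport hχc.mul_left.mul_left
  simp_rw [hpt]
  rw [integral_finsetSum _ fun j _ => hint j]
  calc |∑ j, ∫ y, ⟪b j, f y⟫ * ⟪f y, fderiv ℝ H y (b j)⟫ * (η y * χ y)|
      ≤ ∑ j, |∫ y, ⟪b j, f y⟫ * ⟪f y, fderiv ℝ H y (b j)⟫ * (η y * χ y)| :=
        Finset.abs_sum_le_sum_abs _ _
    _ ≤ ∑ _j : ι, (k * (∫ y, ‖f y‖ ^ 2 * ‖H y‖ * χ y) +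
        (∫ y, ‖f y‖ * ‖H y‖ * (‖fderiv ℝ f y‖ * χ y + ‖f y‖ * ‖fderiv ℝ χ y‖) * η y) +
        ∫ y, ‖f y‖ * ‖fderiv ℝ f y‖ * ‖H y‖ * (η y * χ y)) :=
        Finset.sum_le_sum fun j _ => abs_integral_coord_mul_inner_fderiv_apply_le hf hH hχ hχc hχ0
          hk hη hηc hη0 (le_of_eq (b.orthonormal.1 j))
    _ = _ := by rw [Finset.sum_const, Finset.card_univ, nsmul_eq_mul]

/-- **The form used on each Whitney piece.** If moreover `χ ≤ 1`, `‖Dχ‖ ≤ L`, `η ≤ 4θ` on the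
support of `χ` and `θ L ≤ c_L k`, then
`|∫ ⟪f, DH f⟫ η χ| ≤ (card ι) (2 ∫ ‖Df‖ ‖f‖ ‖H‖ η χ + (1 + 4 c_L) k ∫_{supp χ} ‖f‖² ‖H‖)`.
[folklore] -/
theorem abs_integral_inner_fderiv_apply_self_le_of_piece (b : OrthonormalBasis ι ℝ E)
    (hf : ContDiff ℝ 1 f) (hH : ContDiff ℝ 1 H) (hχ : ContDiff ℝ 1 χ) (hχc : HasCompactSupport χ)
    (hχ01 : ∀ y, χ y ∈ Icc (0 : ℝ) 1) {L : ℝ} (hL : ∀ y, ‖fderiv ℝ χ y‖ ≤ L)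
    (hk : 0 ≤ k) (hη : LipschitzWith (Real.toNNReal k) η) (hηc : HasCompactSupport η)
    (hη0 : ∀ y, 0 ≤ η y) {θ cL : ℝ} (hθ : ∀ y ∈ tsupport χ, η y ≤ 4 * θ) (hcL : θ * L ≤ cL * k) :
    |∫ y, ⟪f y, fderiv ℝ H y (f y)⟫ * (η y * χ y)| ≤
      Fintype.card ι * (2 * (∫ y, ‖fderiv ℝ f y‖ * ‖f y‖ * ‖H y‖ * (η y * χ y)) +
        (1 + 4 * cL) * k * ∫ y in tsupport χ, ‖f y‖ ^ 2 * ‖H y‖) := by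
  have hχ0 : ∀ y, 0 ≤ χ y := fun y => (hχ01 y).1
  have hfc : Continuous f := hf.continuous
  have hHc : Continuous H := hH.continuous
  have hχcont : Continuous χ := hχ.continuous
  have hηcont : Continuous η := hη.continuous
  have hDf : Continuous (fderiv ℝ f) := hf.continuous_fderiv one_ne_zero
  have hDχ : Continuous (fderiv ℝ χ) := hχ.continuous_fderiv one_ne_zero
  have hL0 : 0 ≤ L := (norm_nonneg _).trans (hL 0)
  have hS : MeasurableSet (tsupport χ) := (isClosed_tsupport χ).measurableSet
  have h0 := abs_integral_inner_fderiv_apply_self_le b hf hH hχ hχc hχ0 hk hη hηc hη0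
  set M : ℝ := ∫ y in tsupport χ, ‖f y‖ ^ 2 * ‖H y‖ with hM
  set I : ℝ := ∫ y, ‖fderiv ℝ f y‖ * ‖f y‖ * ‖H y‖ * (η y * χ y) with hI
  -- the mass function `m = 1_S ‖f‖² ‖H‖`
  have hmint : Integrable ((tsupport χ).indicator fun y => ‖f y‖ ^ 2 * ‖H y‖) :=
    (((hfc.norm.pow 2).mul hHc.norm).continuousOn.integrableOn_compact hχc).integrable_indicator hS
  have hMeq : ∫ y, (tsupport χ).indicator (fun y => ‖f y‖ ^ 2 * ‖H y‖) y = M :=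
    integral_indicator hS
  -- (A) `∫ ‖f‖²‖H‖χ ≤ M`
  have hA : ∫ y, ‖f y‖ ^ 2 * ‖H y‖ * χ y ≤ M := by
    rw [← hMeq]
    refine integral_mono_of_nonneg (Eventually.of_forall fun y =>
      mul_nonneg (mul_nonneg (sq_nonneg _) (norm_nonneg _)) (hχ0 y)) hmint
      (Eventually.of_forall fun y => ?_)
    dsimp only
    by_cases hy : y ∈ tsupport χ
    · rw [indicator_of_mem hy]
      calc ‖f y‖ ^ 2 * ‖H y‖ * χ y ≤ ‖f y‖ ^ 2 * ‖H y‖ * 1 := by gcongr; exact (hχ01 y).2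
        _ = ‖f y‖ ^ 2 * ‖H y‖ := mul_one _
    · rw [indicator_of_notMem hy, image_eq_zero_of_notMem_tsupport hy, mul_zero]
  -- (B) the middle integral splits; its second part is `≤ 4 c_L k M`
  have hB1int : Integrable fun y => ‖f y‖ * ‖H y‖ * (‖fderiv ℝ f y‖ * χ y) * η y :=
    (((hfc.norm.mul hHc.norm).mul (hDf.norm.mul hχcont)).mul hηcont).integrable_of_hasCompactSupport
      hηc.mul_left
  have hB2int : Integrable fun y => ‖f y‖ * ‖H y‖ * (‖f y‖ * ‖fderiv ℝ χ y‖) * η y :=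
    (((hfc.norm.mul hHc.norm).mul (hfc.norm.mul hDχ.norm)).mul hηcont).integrable_of_hasCompactSupport
      hηc.mul_left
  have hBsplit : ∫ y, ‖f y‖ * ‖H y‖ * (‖fderiv ℝ f y‖ * χ y + ‖f y‖ * ‖fderiv ℝ χ y‖) * η y =
      (∫ y, ‖f y‖ * ‖H y‖ * (‖fderiv ℝ f y‖ * χ y) * η y) +
        ∫ y, ‖f y‖ * ‖H y‖ * (‖f y‖ * ‖fderiv ℝ χ y‖) * η y := by
    rw [← integral_add hB1int hB2int]
    refine integral_congr_ae (Eventually.of_forall fun y => ?_)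
    ring
  have hB1 : ∫ y, ‖f y‖ * ‖H y‖ * (‖fderiv ℝ f y‖ * χ y) * η y = I := by
    rw [hI]; refine integral_congr_ae (Eventually.of_forall fun y => ?_); ring
  have hB2 : ∫ y, ‖f y‖ * ‖H y‖ * (‖f y‖ * ‖fderiv ℝ χ y‖) * η y ≤ 4 * θ * L * M := by
    rw [← hMeq, ← integral_const_mul]
    refine integral_mono_of_nonneg (Eventually.of_forall fun y => by
        have := hη0 y; positivity) (hmint.const_mul _) (Eventually.of_forall fun y => ?_)
    dsimp only
    by_cases hy : y ∈ tsupport χ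
    · rw [indicator_of_mem hy]
      have h1 : ‖fderiv ℝ χ y‖ * η y ≤ L * (4 * θ) :=
        mul_le_mul (hL y) (hθ y hy) (hη0 y) hL0
      calc ‖f y‖ * ‖H y‖ * (‖f y‖ * ‖fderiv ℝ χ y‖) * η y
          = ‖f y‖ ^ 2 * ‖H y‖ * (‖fderiv ℝ χ y‖ * η y) := by ring
        _ ≤ ‖f y‖ ^ 2 * ‖H y‖ * (L * (4 * θ)) :=
            mul_le_mul_of_nonneg_left h1 (by positivity)
        _ = 4 * θ * L * (‖f y‖ ^ 2 * ‖H y‖) := by ring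
    · rw [indicator_of_notMem hy, fderiv_of_notMem_tsupport ℝ hy, norm_zero]
      simp
  -- (C) the last integral is `I`
  have hC : ∫ y, ‖f y‖ * ‖fderiv ℝ f y‖ * ‖H y‖ * (η y * χ y) = I := by
    rw [hI]; refine integral_congr_ae (Eventually.of_forall fun y => ?_); ring
  have hM0 : 0 ≤ M := by
    rw [← hMeq]; exact integral_nonneg fun y => indicator_nonneg (fun y _ => by positivity) y
  have hcard : (0 : ℝ) ≤ Fintype.card ι := Nat.cast_nonneg _
  have hθLM : 4 * θ * L * M ≤ 4 * cL * k * M := by nlinarith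
  calc |∫ y, ⟪f y, fderiv ℝ H y (f y)⟫ * (η y * χ y)|
      ≤ Fintype.card ι * (k * (∫ y, ‖f y‖ ^ 2 * ‖H y‖ * χ y) +
        (∫ y, ‖f y‖ * ‖H y‖ * (‖fderiv ℝ f y‖ * χ y + ‖f y‖ * ‖fderiv ℝ χ y‖) * η y) +
        ∫ y, ‖f y‖ * ‖fderiv ℝ f y‖ * ‖H y‖ * (η y * χ y)) := h0
    _ ≤ Fintype.card ι * (k * M + (I + 4 * cL * k * M) + I) := by
        rw [hBsplit, hB1, hC]
        gcongr
        · exact hB2.trans hθLM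
    _ = Fintype.card ι * (2 * I + (1 + 4 * cL) * k * M) := by ring

end Sum

end Literature.Analysis.FluidPDE.TaoY6

end
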